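import Mathlib
import Summits.Ventures.PercRepro2.K5Transfer

/-!
# THE PATTERN MAP OF A VERTEX MAP INTO `K₅`
(blind cell PercRepro2, typer-1 g10; p2's subtraction 03:22:27Z, lead g26 03:29:09Z)

Let `ends : E → Sym2 V` be any finite graph, `m : V → Fin 5` a vertex map injective on a set `M` of marks,
`F` a set of edges whose ends all lie in `M`, loop-free and without parallel edges, and pin every edge off
`F` closed (`ClosedOff`).  The PATTERN `patternM ω : Fin 10 → Bool` records, for each pair of `K₅`, whether
the edge of `F` over that pair (`bundleM`) is open; `liftM` is its inverse on the configurations closed off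
`F` (`patternM_injOn`, `patternM_liftM`); `minorFM` / `minorτM` are the pairs carrying an edge of `F` and
their types.

* **`conn_iff_patternM`**: for marks `u, v` and `ω` closed off `F`, `Conn ends ω u v ↔ Conn ends5 (patternM ω)
  (m u) (m v)` — both directions by the closure lemma `mem_of_conn_of_closed`: the open edges join marks
  (`openAdj_patternM`), and every open pair of `K₅` lifts to an open edge of `F` (`conn_of_conn_patternM`).

`K5K3Transfer.lean` transports p1's kernel `K₃` and the typed counts along it.
-/

namespace Summit.Ventures.PercRepro2

open Hub

namespace K5

/-! ## The pattern map of a vertex map -/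

section PatternM

variable {V : Type*} {E : Type*} [Fintype E] [DecidableEq E] [DecidableEq V]
variable (m : V → Fin 5) (ends : E → Sym2 V) (F : Finset E)

/-- The edges of `F` over the pair `j` of `K₅`. -/
def bundleM (j : Fin 10) : Finset E := F.filter fun e => (ends e).map m = ends5 j

/-- The pattern of a configuration: pair `j` is open iff some edge of `F` over it is open. -/
def patternM (ω : Config E) : Fin 10 → Bool := fun j => decide (∃ e ∈ bundleM m ends F j, ω e = true)

/-- The pairs of `K₅` carrying an edge of `F`. -/
def minorFM : Finset (Fin 10) := Finset.univ.filter fun j => ∃ e ∈ F, e ∈ bundleM m ends F j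

/-- The type of a pair: the type of its edge (`0` on empty bundles). -/
def minorτM (τ : E → ℕ) (j : Fin 10) : ℕ := ∑ e ∈ bundleM m ends F j, τ e

/-- The configuration of `G` with the states of a `K₅`-configuration on the pairs (closed off `F`). -/
def liftM (σ : Fin 10 → Bool) : Config E := fun e => decide (∃ j, e ∈ bundleM m ends F j ∧ σ j = true)

/-- A configuration closed off `F`. -/
def ClosedOff (ω : Config E) : Prop := ∀ e, e ∉ F → ω e = false

omit [Fintype E] [DecidableEq E] [DecidableEq V] in
/-- Membership in a bundle. -/
lemma mem_bundleM {e : E} {j : Fin 10} : e ∈ bundleM m ends F j ↔ e ∈ F ∧ (ends e).map m = ends5 j := by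
  unfold bundleM
  rw [Finset.mem_filter]

omit [Fintype E] [DecidableEq E] [DecidableEq V] in
/-- An edge lies in at most one bundle. -/
lemma bundleM_index_unique {e : E} {j j' : Fin 10} (he : e ∈ bundleM m ends F j)
    (he' : e ∈ bundleM m ends F j') : j = j' :=
  ends5_injective (((mem_bundleM m ends F).1 he).2.symm.trans ((mem_bundleM m ends F).1 he').2)

omit [Fintype E] [DecidableEq V] in
/-- Membership in `minorFM`. -/
lemma mem_minorFM {j : Fin 10} : j ∈ minorFM m ends F ↔ ∃ e ∈ F, e ∈ bundleM m ends F j := by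
  unfold minorFM
  rw [Finset.mem_filter]
  exact ⟨fun h => h.2, fun h => ⟨Finset.mem_univ _, h⟩⟩

omit [Fintype E] [DecidableEq E] [DecidableEq V] in
/-- The pattern at a pair carrying no edge is `false`. -/
lemma patternM_of_empty {j : Fin 10} (hj : ∀ e, e ∉ bundleM m ends F j) (ω : Config E) :
    patternM m ends F ω j = false := by
  unfold patternM
  rw [decide_eq_false_iff_not]
  rintro ⟨e, he, -⟩
  exact hj e he

omit [Fintype E] [DecidableEq V] in
/-- The lift at an edge of the pair `j` is the state of `j`. -/
lemma liftM_apply {e : E} {j : Fin 10} (he : e ∈ bundleM m ends F j) (σ : Fin 10 → Bool) :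
    liftM m ends F σ e = σ j := by
  unfold liftM
  rw [Bool.eq_iff_iff, decide_eq_true_iff]
  constructor
  · rintro ⟨j', hj', hs⟩
    rwa [bundleM_index_unique m ends F he hj']
  · intro hs
    exact ⟨j, he, hs⟩

omit [Fintype E] [DecidableEq V] in
/-- The lift is closed off `F`. -/
lemma liftM_closedOff (σ : Fin 10 → Bool) : ClosedOff F (liftM m ends F σ) := by
  intro e he
  unfold liftM
  rw [decide_eq_false_iff_not]
  rintro ⟨j, hj, -⟩
  exact he ((mem_bundleM m ends F).1 hj).1

/-! ### The hypotheses: marks, injectivity, no loops, no parallels -/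

variable {M : Set V}

omit [DecidableEq V] in
/-- Images of pairs of marks under an injective map determine the pairs. -/
lemma sym2_map_inj_of_mem (hinj : Set.InjOn m M) {u v u' v' : V} (hu : u ∈ M) (hv : v ∈ M)
    (hu' : u' ∈ M) (hv' : v' ∈ M) (h : s(m u, m v) = s(m u', m v')) : s(u, v) = s(u', v') := by
  rw [Sym2.eq_iff] at h ⊢
  rcases h with ⟨h1, h2⟩ | ⟨h1, h2⟩
  · exact Or.inl ⟨hinj hu hu' h1, hinj hv hv' h2⟩
  · exact Or.inr ⟨hinj hu hv' h1, hinj hv hu' h2⟩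

omit [Fintype E] [DecidableEq E] [DecidableEq V] in
/-- Both ends of an edge of `F` are marks, as a statement about the pair. -/
lemma ends_eq_of_mem (hM : ∀ e ∈ F, ∀ v ∈ ends e, v ∈ M) {e : E} (he : e ∈ F) :
    ∃ u v, u ∈ M ∧ v ∈ M ∧ ends e = s(u, v) := by
  induction hs : ends e using Sym2.ind with
  | _ u v =>
    exact ⟨u, v, hM e he u (by rw [hs]; exact Sym2.mem_mk_left u v),
      hM e he v (by rw [hs]; exact Sym2.mem_mk_right u v), rfl⟩

omit [Fintype E] [DecidableEq E] [DecidableEq V] in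
/-- Without parallel edges (on `F`) a bundle has at most one edge. -/
lemma bundleM_eq_of_mem (hinj : Set.InjOn m M) (hM : ∀ e ∈ F, ∀ v ∈ ends e, v ∈ M)
    (hpar : ∀ e ∈ F, ∀ e' ∈ F, ends e = ends e' → e = e') {e e' : E} {j : Fin 10}
    (he : e ∈ bundleM m ends F j) (he' : e' ∈ bundleM m ends F j) : e = e' := by
  obtain ⟨heF, h1⟩ := (mem_bundleM m ends F).1 he
  obtain ⟨he'F, h2⟩ := (mem_bundleM m ends F).1 he'
  obtain ⟨u, v, hu, hv, huv⟩ := ends_eq_of_mem ends F hM heF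
  obtain ⟨u', v', hu', hv', huv'⟩ := ends_eq_of_mem ends F hM he'F
  refine hpar e heF e' he'F ?_
  rw [huv, huv']
  refine sym2_map_inj_of_mem m hinj hu hv hu' hv' ?_
  rw [huv, Sym2.map_mk] at h1
  rw [huv', Sym2.map_mk] at h2
  exact h1.trans h2.symm

omit [Fintype E] [DecidableEq E] [DecidableEq V] in
/-- A loop-free edge of `F` lies in some bundle. -/
lemma exists_bundleM (hinj : Set.InjOn m M) (hM : ∀ e ∈ F, ∀ v ∈ ends e, v ∈ M)
    (hloop : ∀ e ∈ F, ¬ (ends e).IsDiag) {e : E} (he : e ∈ F) : ∃ j, e ∈ bundleM m ends F j := by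
  obtain ⟨u, v, hu, hv, huv⟩ := ends_eq_of_mem ends F hM he
  have hne : u ≠ v := by
    intro h
    apply hloop e he
    rw [huv, h]
    exact Sym2.mk_isDiag_iff.2 rfl
  obtain ⟨j, hj⟩ := exists_edge5 (m u) (m v) (fun h => hne (hinj hu hv h))
  refine ⟨j, (mem_bundleM m ends F).2 ⟨he, ?_⟩⟩
  rw [huv, Sym2.map_mk, hj]

omit [Fintype E] [DecidableEq E] [DecidableEq V] in
/-- The pattern at a pair carrying the edge `e` is the state of `e`. -/
lemma patternM_of_mem (hinj : Set.InjOn m M) (hM : ∀ e ∈ F, ∀ v ∈ ends e, v ∈ M)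
    (hpar : ∀ e ∈ F, ∀ e' ∈ F, ends e = ends e' → e = e') {e : E} {j : Fin 10}
    (he : e ∈ bundleM m ends F j) (x : Config E) : patternM m ends F x j = x e := by
  unfold patternM
  rw [Bool.eq_iff_iff, decide_eq_true_iff]
  constructor
  · rintro ⟨e', he', hx⟩
    rwa [bundleM_eq_of_mem m ends F hinj hM hpar he he']
  · intro hx
    exact ⟨e, he, hx⟩

omit [Fintype E] [DecidableEq V] in
/-- On configurations closed off `F` the pattern map is injective. -/
lemma patternM_injOn (hinj : Set.InjOn m M) (hM : ∀ e ∈ F, ∀ v ∈ ends e, v ∈ M)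
    (hloop : ∀ e ∈ F, ¬ (ends e).IsDiag) (hpar : ∀ e ∈ F, ∀ e' ∈ F, ends e = ends e' → e = e')
    {x x' : Config E} (hx : ClosedOff F x) (hx' : ClosedOff F x')
    (h : patternM m ends F x = patternM m ends F x') : x = x' := by
  funext e
  by_cases he : e ∈ F
  · obtain ⟨j, hj⟩ := exists_bundleM m ends F hinj hM hloop he
    rw [← patternM_of_mem m ends F hinj hM hpar hj x, ← patternM_of_mem m ends F hinj hM hpar hj x', h]
  · rw [hx e he, hx' e he]

omit [DecidableEq V] in
/-- The pattern of a lift is the configuration, when it vanishes on the empty pairs. -/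
lemma patternM_liftM (hinj : Set.InjOn m M) (hM : ∀ e ∈ F, ∀ v ∈ ends e, v ∈ M)
    (hpar : ∀ e ∈ F, ∀ e' ∈ F, ends e = ends e' → e = e') (σ : Fin 10 → Bool)
    (hσ : ∀ j, (∀ e, e ∉ bundleM m ends F j) → σ j = false) :
    patternM m ends F (liftM m ends F σ) = σ := by
  funext j
  by_cases hj : ∃ e, e ∈ bundleM m ends F j
  · obtain ⟨e, he⟩ := hj
    rw [patternM_of_mem m ends F hinj hM hpar he, liftM_apply m ends F he]
  · have hj' : ∀ e, e ∉ bundleM m ends F j := fun e he => hj ⟨e, he⟩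
    rw [patternM_of_empty m ends F hj', hσ j hj']

omit [Fintype E] [DecidableEq E] [DecidableEq V] in
/-- The type of a pair carrying the edge `e` is `τ e`. -/
lemma minorτM_of_mem (hinj : Set.InjOn m M) (hM : ∀ e ∈ F, ∀ v ∈ ends e, v ∈ M)
    (hpar : ∀ e ∈ F, ∀ e' ∈ F, ends e = ends e' → e = e') {e : E} {j : Fin 10}
    (he : e ∈ bundleM m ends F j) (τ : E → ℕ) : minorτM m ends F τ j = τ e := by
  unfold minorτM
  exact Finset.sum_eq_single_of_mem e he fun e' he' hne =>
    (hne (bundleM_eq_of_mem m ends F hinj hM hpar he' he)).elim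

/-! ### Connectivity transfers -/

omit [Fintype E] [DecidableEq V] in
/-- **An open edge of `G` (closed off `F`) is an open pair of `K₅`.** -/
lemma openAdj_patternM (hinj : Set.InjOn m M) (hM : ∀ e ∈ F, ∀ v ∈ ends e, v ∈ M)
    (hloop : ∀ e ∈ F, ¬ (ends e).IsDiag) {ω : Config E} (hω : ClosedOff F ω) {u v : V}
    (h : OpenAdj ends ω u v) : OpenAdj ends5 (patternM m ends F ω) (m u) (m v) := by
  obtain ⟨e, he, hends⟩ := h
  have heF : e ∈ F := by
    by_contra hF
    rw [hω e hF] at he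
    exact Bool.false_ne_true he
  obtain ⟨j, hj⟩ := exists_bundleM m ends F hinj hM hloop heF
  refine ⟨j, ?_, ?_⟩
  · unfold patternM
    rw [decide_eq_true_iff]
    exact ⟨e, hj, he⟩
  · have := ((mem_bundleM m ends F).1 hj).2
    rw [hends, Sym2.map_mk] at this
    exact this.symm

omit [Fintype E] [DecidableEq V] in
/-- **Connectivity of `G` transfers to `K₅`** (marks, closed off `F`). -/
lemma conn_patternM_of_conn (hinj : Set.InjOn m M) (hM : ∀ e ∈ F, ∀ v ∈ ends e, v ∈ M)
    (hloop : ∀ e ∈ F, ¬ (ends e).IsDiag) {ω : Config E} (hω : ClosedOff F ω) {u v : V} (hu : u ∈ M)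
    (h : Conn ends ω u v) : Conn ends5 (patternM m ends F ω) (m u) (m v) := by
  have hS := mem_of_conn_of_closed (S := {x | x ∈ M ∧ Conn ends5 (patternM m ends F ω) (m u) (m x)})
    (fun x hx y hxy => ?_) ⟨hu, conn_refl _ _ _⟩ h
  · exact hS.2
  · obtain ⟨hne, e, he, hends⟩ := openGraph_adj.1 hxy
    have heF : e ∈ F := by
      by_contra hF
      rw [hω e hF] at he
      exact Bool.false_ne_true he
    have hyM : y ∈ M := hM e heF y (by rw [hends]; exact Sym2.mem_mk_right x y)
    refine ⟨hyM, conn_trans hx.2 (conn_of_openAdj ?_)⟩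
    exact openAdj_patternM m ends F hinj hM hloop hω ⟨e, he, hends⟩

omit [Fintype E] [DecidableEq E] [DecidableEq V] in
/-- **Connectivity of `K₅` lifts to `G`** (marks). -/
lemma conn_of_conn_patternM (hinj : Set.InjOn m M) (hM : ∀ e ∈ F, ∀ v ∈ ends e, v ∈ M)
    {ω : Config E} {u v : V} (hu : u ∈ M) (hv : v ∈ M)
    (h : Conn ends5 (patternM m ends F ω) (m u) (m v)) : Conn ends ω u v := by
  have hS := mem_of_conn_of_closed (S := {p : Fin 5 | ∃ x ∈ M, m x = p ∧ Conn ends ω u x})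
    (fun p hp q hpq => ?_) ⟨u, hu, rfl, conn_refl _ _ _⟩ h
  · obtain ⟨x, hx, hmx, hux⟩ := hS
    rwa [hinj hx hv hmx] at hux
  · obtain ⟨x, hx, hmx, hux⟩ := hp
    obtain ⟨hne, j, hj, hends⟩ := openGraph_adj.1 hpq
    unfold patternM at hj
    rw [decide_eq_true_iff] at hj
    obtain ⟨e, he, hωe⟩ := hj
    obtain ⟨heF, hmap⟩ := (mem_bundleM m ends F).1 he
    obtain ⟨x', y', hx', hy', hxy'⟩ := ends_eq_of_mem ends F hM heF
    rw [hxy', Sym2.map_mk, hends, Sym2.eq_iff] at hmap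
    rcases hmap with ⟨h1, h2⟩ | ⟨h1, h2⟩
    · have hxx : x' = x := hinj hx' hx (h1.trans hmx.symm)
      refine ⟨y', hy', h2, conn_trans hux (conn_of_openAdj ⟨e, hωe, ?_⟩)⟩
      rw [hxy', hxx]
    · have hyx : y' = x := hinj hy' hx (h2.trans hmx.symm)
      refine ⟨x', hx', h1, conn_trans hux (conn_of_openAdj ⟨e, hωe, ?_⟩)⟩
      rw [hxy', hyx, Sym2.eq_swap]

omit [Fintype E] [DecidableEq V] in
/-- **`Conn ends ω u v ↔ Conn ends5 (patternM ω) (m u) (m v)`** for marks `u, v` and `ω` closed off `F`. -/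
theorem conn_iff_patternM (hinj : Set.InjOn m M) (hM : ∀ e ∈ F, ∀ v ∈ ends e, v ∈ M)
    (hloop : ∀ e ∈ F, ¬ (ends e).IsDiag) {ω : Config E} (hω : ClosedOff F ω) {u v : V} (hu : u ∈ M)
    (hv : v ∈ M) : Conn ends ω u v ↔ Conn ends5 (patternM m ends F ω) (m u) (m v) :=
  ⟨conn_patternM_of_conn m ends F hinj hM hloop hω hu,
    conn_of_conn_patternM m ends F hinj hM hu hv⟩

end PatternM

end K5

end Summit.Ventures.PercRepro2
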